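import Summits.HodgeConjecture.HodgeConjecture.Theorems.DerivedTorelliFermatAssembly
import Summits.HodgeConjecture.HodgeConjecture.Theorems.DerivedTorelliFermatHypersurfaceLefschetz
import Literature.AlgebraicGeometry.HodgeTheory.MiddleDimensionReductionProofs
import Literature.AlgebraicGeometry.HodgeTheory.HodgeTypeExteriorProduct
import Literature.AlgebraicGeometry.HodgeTheory.ComplexConjugationHolds

/-!
# STRATEGY CENSUS companion r1 — `DerivedTorelliFermat.ResidualSectorComplement`
# (stmt-HodgeConjecture-13828)

Crux-strategist REDIRECT r1 (second opinion after s2), seat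
`planner-cstrat-stmt-HodgeConjecture-13828-r1-0`, 2026-08-17, route
`route-HodgeConjecture-DerivedTorelliFermat` rev 7. Companion of
`Cruxes/ResidualSectorComplement/STRATEGY-CENSUS-r1.md`. Nothing here asserts a Theses decl: every
statement is an implication FROM the summit, an equivalence, an implication from the route's own
items, or a theorem about honest readings of "the complement of the route's sector".

Notation. `T := FermatFourfoldsHCModResidual` (the route target: for every degree `m ≥ 1`, IF the
residual eigenlines of the Fermat fourfold `X⁴ₘ` are algebraic THEN HC holds for every smooth
projective Fermat fourfold of degree `m`), `C := ResidualSectorComplement := T → HodgeConjecture`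
(THIS crux), `S := _root_.HodgeConjecture` (the sub-problem Statement).

* §1 truth table / costume: `S → T`, `S → C`, **`C ↔ (T ↔ S)`**, `C ↔ (¬S → ¬T)`, `S ↔ T ∧ C`,
  `¬C ↔ T ∧ ¬S`, `C ↔ ¬T ∨ S`, and — NEW w.r.t. s2 — **modulo the route's three open Fermat-side
  items the crux is LITERALLY the summit**: `EigenspaceInputs → ShiodaAokiSupply →
  K3SectorAlgebraic → (C ↔ S)`, by the LANDED theorems `derivedTorelliFermat_assembly_proof`,
  `derivedTorelliFermat_hypersurfaceLefschetz_proof`, `HodgeModels_holds` (no unproved input).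
* §2 the HONEST complement is the summit, kernel-checked with NO unproved fact: the sector consists
  of fourfolds, and HC in dimension 5 already gives HC in dimension 4 (`X ↦ X × ℙ¹`, the tree's
  proved ℙ¹-step), so `OffDimFour ↔ S` and `OffFermatFourfolds ↔ S` (HC off ALL Fermat fourfolds of
  ALL degrees — a superset of the route's sector — is already the whole conjecture).
* §3 law of lines and of splits: `(P → C) ↔ (P ∧ T → S)`; anatomy of a `T`-using split.
* §4 the typed REACH of the only `T`-using levers in print (deformation / Noether–Lefschetz transfer
  from the Fermat point): `HypersurfaceFourfoldsHC`; its residual `HypersurfaceFourfoldsHC → S` is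
  implied by the crux and equivalent to it as soon as the transfer piece is granted; and the honest
  complement of hypersurface fourfolds is again `S` (§2).
* §5 s2's split revisited without restating the residual hypothesis: `FermatFourfoldsHC → T`,
  `C → (FermatFourfoldsHC → S)`, `(T → FermatFourfoldsHC) → ((FermatFourfoldsHC → S) ↔ C)`.
* §6 negation shape, sharpened: a counterexample to `C` is a proof of `T` AND a non-algebraic Hodge
  class which may be taken in dimension `≠ 4` — entirely outside the route's universe.
-/

set_option linter.dupNamespace false
set_option autoImplicit false

noncomputable section

open scoped BigOperators
open CategoryTheory MonoidalCategory CartesianMonoidalCategory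
open Literature.AlgebraicGeometry Literature.AlgebraicGeometry.Motives
open Literature.AlgebraicGeometry.HodgeTheory

namespace Summit.HodgeConjecture.HodgeConjecture.Cruxes.ResidualSectorComplement.StrategistCensusR1

open Summit.HodgeConjecture.HodgeConjecture.Theses.DerivedTorelliFermat

/-! ## §1 Truth table — the crux is "T ↔ S"; modulo the route's open items it is "S" -/

/-- `S → T`: the route target is a special case of the summit (Fermat fourfolds are smooth
projective fourfolds; the residual hypothesis is simply dropped). -/
theorem target_of_summit (hS : _root_.HodgeConjecture) : FermatFourfoldsHCModResidual :=
  fun _m _ _hR _X _hF hX ↦ hS hX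

/-- BC2 converse probe `S → C`, by a term: the crux is a CONSEQUENCE of the summit. -/
theorem residualSectorComplement_of_summit (hS : _root_.HodgeConjecture) :
    ResidualSectorComplement :=
  fun _ ↦ hS

/-- **Costume theorem.** `C ↔ (T ↔ S)`: the crux asserts exactly that the (residual-conditional)
Hodge conjecture for Fermat fourfolds is EQUIVALENT to the full Hodge conjecture in all dimensions. -/
theorem residualSectorComplement_iff_target_iff_summit :
    ResidualSectorComplement ↔ (FermatFourfoldsHCModResidual ↔ _root_.HodgeConjecture) :=
  ⟨fun hC ↦ ⟨hC, target_of_summit⟩, fun h ↦ h.1⟩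

/-- Universality reading `C ↔ (¬S → ¬T)`: "if HC fails anywhere, in any dimension, then for some
degree `m` the residual eigenlines of `X⁴ₘ` are algebraic and yet HC fails on a Fermat fourfold of
degree `m`". -/
theorem residualSectorComplement_iff_contrapositive :
    ResidualSectorComplement ↔ (¬ _root_.HodgeConjecture → ¬ FermatFourfoldsHCModResidual) :=
  ⟨fun hC hnS hT ↦ hnS (hC hT), fun h hT ↦ Classical.byContradiction fun hnS ↦ h hnS hT⟩

/-- `S ↔ T ∧ C`: the crux is precisely "the summit minus the route target" (bridge split
`T ∧ (T → S)`; `closes` is modus ponens). -/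
theorem summit_iff_target_and_residualSectorComplement :
    _root_.HodgeConjecture ↔ FermatFourfoldsHCModResidual ∧ ResidualSectorComplement :=
  ⟨fun hS ↦ ⟨target_of_summit hS, residualSectorComplement_of_summit hS⟩, fun h ↦ h.2 h.1⟩

/-- Kill shape `¬C ↔ T ∧ ¬S`: a refutation of the crux must PROVE the route target and DISPROVE
the Hodge conjecture. -/
theorem not_residualSectorComplement_iff :
    ¬ ResidualSectorComplement ↔ FermatFourfoldsHCModResidual ∧ ¬ _root_.HodgeConjecture := by
  constructor
  · intro h
    have hnS : ¬ _root_.HodgeConjecture := fun hS ↦ h (residualSectorComplement_of_summit hS)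
    exact ⟨Classical.byContradiction fun hnT ↦ h fun hT ↦ absurd hT hnT, hnS⟩
  · rintro ⟨hT, hnS⟩ hC
    exact hnS (hC hT)

/-- Truth table `C ↔ ¬T ∨ S`. -/
theorem residualSectorComplement_iff_not_target_or :
    ResidualSectorComplement ↔ ¬ FermatFourfoldsHCModResidual ∨ _root_.HodgeConjecture := by
  constructor
  · intro hC
    by_cases hT : FermatFourfoldsHCModResidual
    · exact Or.inr (hC hT)
    · exact Or.inl hT
  · rintro (hnT | hS) hT
    · exact absurd hT hnT
    · exact hS

/-- Modulo the route target the crux IS the summit. -/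
theorem residualSectorComplement_iff_summit_of_target (hT : FermatFourfoldsHCModResidual) :
    ResidualSectorComplement ↔ _root_.HodgeConjecture :=
  ⟨fun hC ↦ hC hT, residualSectorComplement_of_summit⟩

/-- The route target from the route's three OPEN Fermat-side items, by LANDED theorems only
(`derivedTorelliFermat_targetGlue_proof`, `derivedTorelliFermat_hypersurfaceLefschetz_proof`,
`HodgeModels_holds`). -/
theorem target_of_items (hE : EigenspaceInputs) (hS : ShiodaAokiSupply) (hK : K3SectorAlgebraic) :
    FermatFourfoldsHCModResidual :=
  Summit.HodgeConjecture.HodgeConjecture.Theorems.derivedTorelliFermat_targetGlue_proof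
    Summit.HodgeConjecture.HodgeConjecture.Theorems.derivedTorelliFermat_hypersurfaceLefschetz_proof
    HodgeModels_holds hE hS hK

/-- **Modulo the route's open items the crux is LITERALLY the summit**:
`EigenspaceInputs → ShiodaAokiSupply → K3SectorAlgebraic → (C ↔ S)`, the forward direction being the
landed assembly `derivedTorelliFermat_assembly_proof` fed with the landed Lefschetz item and
`HodgeModels_holds`. So on the day the route's sector work is complete, what remains under the name
`ResidualSectorComplement` is `HodgeConjecture` itself, with nothing from the route usable toward it. -/
theorem residualSectorComplement_iff_summit_of_items (hE : EigenspaceInputs) (hS : ShiodaAokiSupply)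
    (hK : K3SectorAlgebraic) : ResidualSectorComplement ↔ _root_.HodgeConjecture :=
  ⟨fun hC ↦ Summit.HodgeConjecture.HodgeConjecture.Theorems.derivedTorelliFermat_assembly_proof
      Summit.HodgeConjecture.HodgeConjecture.Theorems.derivedTorelliFermat_hypersurfaceLefschetz_proof
      HodgeModels_holds hE hS hK hC,
    fun h _ ↦ h⟩

/-! ## §2 The honest complement of a sector of FOURFOLDS is the full Hodge conjecture

The route's sector consists of smooth projective varieties of dimension 4 (Fermat fourfolds, minus
their residual eigenlines). "HC off the sector", read honestly, CONTAINS HC in every dimension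
`n ≠ 4`; and HC in dimension 5 alone already returns HC in dimension 4 by the product trick
`X ↦ X × ℙ¹` — PROVED in the tree (`mem_algebraicClasses_of_projectiveLine_of_preservesHodgeType`,
fed with `preservesHodgeType_of_isSmoothProjective`, `IsSmoothProjective.tensor_holds`,
`isSmoothProjective_projectiveSpace_holds`, `nonempty_hodgeModel_holds`). -/

/-- HC in every dimension other than 4 — the weakest honest reading of "HC off a sector of
fourfolds". -/
def OffDimFour : Prop :=
  ∀ ⦃n : ℕ⦄ ⦃X : SchemeOver ℂ⦄, n ≠ 4 → IsSmoothProjective n X → HodgeConjectureFor n X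

/-- **HC for the fivefold `X × ℙ¹` gives HC for the fourfold `X`** (all codimensions), with no
unproved input. [cite: BrosnanFangNiePearlstein2009, §6 Lemma 48 (proof)] -/
theorem hodgeConjectureFor_of_projectiveLine {n : ℕ} {X : SchemeOver ℂ}
    (hX : IsSmoothProjective n X)
    (h : HodgeConjectureFor (n + 1) (X ⊗ projectiveSpace 1 ℂ)) : HodgeConjectureFor n X := by
  have hP : IsSmoothProjective 1 (projectiveSpace 1 ℂ) := isSmoothProjective_projectiveSpace_holds ℂ 1
  have hXP : IsSmoothProjective (n + 1) (X ⊗ projectiveSpace 1 ℂ) :=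
    IsSmoothProjective.tensor_holds hX hP
  refine ⟨nonempty_hodgeModel_holds hX, fun p c hc hpp ↦ ?_⟩
  exact mem_algebraicClasses_of_projectiveLine_of_preservesHodgeType hX
    (preservesHodgeType_of_isSmoothProjective hXP hX (fst X (projectiveSpace 1 ℂ)))
    (fun κ hκ hκpp ↦ h.2 p κ hκ hκpp) c hc hpp

/-- **`OffDimFour ↔ HodgeConjecture`**: excluding ALL fourfolds from the Hodge conjecture loses
nothing. A fortiori excluding the Fermat fourfolds loses nothing. -/
theorem offDimFour_iff_summit : OffDimFour ↔ _root_.HodgeConjecture := by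
  constructor
  · intro h n X hX
    by_cases hn : n = 4
    · subst hn
      have hP : IsSmoothProjective 1 (projectiveSpace 1 ℂ) :=
        isSmoothProjective_projectiveSpace_holds ℂ 1
      exact hodgeConjectureFor_of_projectiveLine hX
        (h (by norm_num) (IsSmoothProjective.tensor_holds hX hP))
    · exact h hn hX
  · intro hS n X _ hX
    exact hS hX

/-- Membership of `X` (of dimension `n`) in the LARGEST sector the route could ever claim: `n = 4`
and `X` is a Fermat variety `X⁴ₘ` of some degree `m ≥ 1` (all eigenlines, residual or not). -/
def InFermatFourfoldSector (n : ℕ) (X : SchemeOver ℂ) : Prop :=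
  n = 4 ∧ ∃ m : ℕ, m ≠ 0 ∧ IsFermatVariety 4 m X

/-- The HONEST complement of (a superset of) the sector: HC for every smooth projective variety
that is NOT a Fermat fourfold. -/
def OffFermatFourfolds : Prop :=
  ∀ ⦃n : ℕ⦄ ⦃X : SchemeOver ℂ⦄, IsSmoothProjective n X → ¬ InFermatFourfoldSector n X →
    HodgeConjectureFor n X

/-- The honest complement contains HC in every dimension `≠ 4`. -/
theorem offDimFour_of_offFermatFourfolds (h : OffFermatFourfolds) : OffDimFour :=
  fun _n _X hn hX ↦ h hX fun hin ↦ hn hin.1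

/-- **The honest complement is the summit**: `OffFermatFourfolds ↔ HodgeConjecture`,
kernel-checked. "HC off the Fermat fourfolds" is not a residual at all — it is the whole Hodge
conjecture, and the route's `T` buys nothing toward it. -/
theorem offFermatFourfolds_iff_summit : OffFermatFourfolds ↔ _root_.HodgeConjecture :=
  ⟨fun h ↦ offDimFour_iff_summit.1 (offDimFour_of_offFermatFourfolds h), fun hS _ _ hX _ ↦ hS hX⟩

/-- The honest complement implies the typed crux (the route typed the WEAKEST statement that closes
with `T`, namely `T → S`; every stronger honest reading is literally `S`). -/
theorem residualSectorComplement_of_offFermatFourfolds (h : OffFermatFourfolds) :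
    ResidualSectorComplement :=
  residualSectorComplement_of_summit (offFermatFourfolds_iff_summit.1 h)

/-- The crux is equivalent to "the route target (fourfolds) implies HC in every dimension other
than 4" — hypothesis and conclusion live in disjoint dimensions. -/
theorem residualSectorComplement_iff_target_imp_offDimFour :
    ResidualSectorComplement ↔ (FermatFourfoldsHCModResidual → OffDimFour) :=
  ⟨fun hC hT ↦ offDimFour_iff_summit.2 (hC hT), fun h hT ↦ offDimFour_iff_summit.1 (h hT)⟩

/-! ## §3 Law of lines and of splits -/

/-- **Law of lines.** Any stub set / hypothesis `P` concluding the crux is a proof of the summit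
from `P ∧ T`: `(P → C) ↔ (P ∧ T → S)`. -/
theorem law_of_lines (P : Prop) :
    (P → ResidualSectorComplement) ↔ (P ∧ FermatFourfoldsHCModResidual → _root_.HodgeConjecture) :=
  ⟨fun h hp ↦ h hp.1 hp.2, fun h hP hT ↦ h ⟨hP, hT⟩⟩

/-- **Law of splits.** A decomposition `X₁ → X₂ → C` is a proof of HC from `X₁ ∧ X₂ ∧ T`. Either no
piece uses `T` (Family A: the pieces prove `S` outright — a decomposition of the SUMMIT, some other
route's item list, `T` decorative), or some piece consumes `T` (Family B: a transfer of HC from the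
Fermat fourfolds to other varieties). -/
theorem law_of_splits (X₁ X₂ : Prop) :
    (X₁ → X₂ → ResidualSectorComplement) ↔
      (X₁ ∧ X₂ ∧ FermatFourfoldsHCModResidual → _root_.HodgeConjecture) :=
  ⟨fun h hx ↦ h hx.1 hx.2.1 hx.2.2, fun h h₁ h₂ hT ↦ h ⟨h₁, h₂, hT⟩⟩

/-- Family-B anatomy. A `T`-using split has the shape `(T → E) ∧ (E → S)` for the REACH `E` of the
lever. If `E` contains the target (`E → T`, automatic when `E` is "HC on a class of fourfolds
containing the Fermat ones"), the residual `E → S` is implied by the crux … -/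
theorem residual_of_residualSectorComplement {E : Prop} (hET : E → FermatFourfoldsHCModResidual) :
    ResidualSectorComplement → (E → _root_.HodgeConjecture) :=
  fun hC hE ↦ hC (hET hE)

/-- … and is EQUIVALENT to the crux as soon as the transfer piece `T → E` is available: in every
`T`-using split whose transfer piece is a theorem, the residual piece is the crux in costume (fails
BC2 (c)); and if the transfer piece is itself open, the split has TWO unplanned pieces. -/
theorem residual_iff_residualSectorComplement {E : Prop} (hTE : FermatFourfoldsHCModResidual → E)
    (hET : E → FermatFourfoldsHCModResidual) :
    (E → _root_.HodgeConjecture) ↔ ResidualSectorComplement :=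
  ⟨fun h hT ↦ h (hTE hT), residual_of_residualSectorComplement hET⟩

/-- Family-B assembly (trivially valid for any reach `E`). -/
theorem residualSectorComplement_of_transfer_of_residual {E : Prop}
    (hTE : FermatFourfoldsHCModResidual → E) (hres : E → _root_.HodgeConjecture) :
    ResidualSectorComplement :=
  fun hT ↦ hres (hTE hT)

/-! ## §4 Transfer — the typed reach of the levers that USE `T` off the sector

The `T`-using levers in print all move HC from the Fermat point `X⁴ₘ` to OTHER SMOOTH HYPERSURFACE
FOURFOLDS of the same degree (variational Hodge conjecture along the universal family of degree-`m`
hypersurfaces in `ℙ⁵`; Noether–Lefschetz / Hodge loci through the Fermat point, Movasati–Villaflor;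
Bloch's semiregularity). Their maximal reach is therefore contained in -/

/-- HC for every smooth hypersurface fourfold `Y ⊂ ℙ⁵_ℂ` of every degree. -/
def HypersurfaceFourfoldsHC : Prop :=
  ∀ ⦃d : ℕ⦄ ⦃Y : SchemeOver ℂ⦄, IsSmoothHypersurface 4 d Y → HodgeConjectureFor 4 Y

/-- The reach contains the target: a smooth projective Fermat fourfold of degree `m ≥ 1` is a smooth
hypersurface fourfold (`isSmoothHypersurface_of_isFermatVariety`), and the residual hypothesis of
`T` is simply dropped. -/
theorem target_of_hypersurfaceFourfoldsHC (h : HypersurfaceFourfoldsHC) :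
    FermatFourfoldsHCModResidual :=
  fun m _ _hR _X hF hX ↦
    h (isSmoothHypersurface_of_isFermatVariety hX hF (by norm_num) (Nat.pos_of_ne_zero (NeZero.ne m)))

/-- `S → HypersurfaceFourfoldsHC` (hypersurfaces are smooth projective). -/
theorem hypersurfaceFourfoldsHC_of_summit (hS : _root_.HodgeConjecture) : HypersurfaceFourfoldsHC :=
  fun _d _Y hY ↦ hS hY.1

/-- The residual of the deformation split is implied by the crux … -/
theorem hypersurface_residual_of_residualSectorComplement (hC : ResidualSectorComplement) :
    HypersurfaceFourfoldsHC → _root_.HodgeConjecture :=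
  residual_of_residualSectorComplement target_of_hypersurfaceFourfoldsHC hC

/-- … and **granted the (open) transfer piece `T → HypersurfaceFourfoldsHC` the residual IS the
crux**: `(HypersurfaceFourfoldsHC → S) ↔ C`. So the deformation / Noether–Lefschetz split
`(T → HypersurfaceFourfoldsHC) ∧ (HypersurfaceFourfoldsHC → S)` has an open transfer piece (the
variational Hodge conjecture for hypersurface fourfolds, another route's crux) AND a residual piece
that is this crux reworded — no piece is planned, BC2 (c)/(d) fail. -/
theorem hypersurface_residual_iff (hTE : FermatFourfoldsHCModResidual → HypersurfaceFourfoldsHC) :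
    (HypersurfaceFourfoldsHC → _root_.HodgeConjecture) ↔ ResidualSectorComplement :=
  residual_iff_residualSectorComplement hTE target_of_hypersurfaceFourfoldsHC

/-- Hypersurface fourfolds are fourfolds: the honest complement of the ENLARGED sector still contains
`OffDimFour`, hence is the summit again (§2). Recorded as: the residual of the deformation split is
equivalent to "hypersurface fourfolds imply HC off dimension 4". -/
theorem hypersurface_residual_iff_offDimFour :
    (HypersurfaceFourfoldsHC → _root_.HodgeConjecture) ↔ (HypersurfaceFourfoldsHC → OffDimFour) :=
  ⟨fun h hH ↦ offDimFour_iff_summit.2 (h hH), fun h hH ↦ offDimFour_iff_summit.1 (h hH)⟩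

/-! ## §5 s2's split revisited (ResidualDischarge × complement), without restating the residual
hypothesis: discharging the residual eigenlines turns `T` into unconditional HC for all Fermat
fourfolds, and the complement of THAT is the crux again. -/

/-- HC for every smooth projective Fermat fourfold of every degree `m ≥ 1` (the rev-2 target
`FermatFourfoldsHC`, stmt-HodgeConjecture-11118/13827, now retired in favour of `T`). -/
def FermatFourfoldsHC : Prop :=
  ∀ (m : ℕ) [NeZero m] (X : SchemeOver ℂ), IsFermatVariety 4 m X → IsSmoothProjective 4 X →
    HodgeConjectureFor 4 X

/-- Unconditional Fermat-fourfold HC gives the residual-conditional target. -/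
theorem target_of_fermatFourfoldsHC (h : FermatFourfoldsHC) : FermatFourfoldsHCModResidual :=
  fun m _ _hR X hF hX ↦ h m X hF hX

/-- `S → FermatFourfoldsHC`. -/
theorem fermatFourfoldsHC_of_summit (hS : _root_.HodgeConjecture) : FermatFourfoldsHC :=
  fun _m _ _X _hF hX ↦ hS hX

/-- The complement of ALL Fermat fourfolds (typed as an implication) is implied by the crux … -/
theorem fermat_residual_of_residualSectorComplement (hC : ResidualSectorComplement) :
    FermatFourfoldsHC → _root_.HodgeConjecture :=
  residual_of_residualSectorComplement target_of_fermatFourfoldsHC hC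

/-- … and is the crux itself as soon as the residual eigenlines are discharged (`T → FermatFourfoldsHC`
is exactly "ResidualDischarge suffices", s2's piece 1): `(FermatFourfoldsHC → S) ↔ C`. s2's piece 2
(`SummitOffFermatFourfolds`) is therefore the crux reworded, and read honestly (§2,
`offFermatFourfolds_iff_summit`) it is the summit. -/
theorem fermat_residual_iff (hRD : FermatFourfoldsHCModResidual → FermatFourfoldsHC) :
    (FermatFourfoldsHC → _root_.HodgeConjecture) ↔ ResidualSectorComplement :=
  residual_iff_residualSectorComplement hRD target_of_fermatFourfoldsHC

/-- By-dimension split fails too: "`T` → HC₄" ∧ "HC off dimension 4" has second piece `≡ S`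
(`offDimFour_iff_summit`), first piece unplanned (universality of Fermat fourfolds among fourfolds). -/
theorem byDimension_split (_h₄ : FermatFourfoldsHCModResidual →
      ∀ ⦃X : SchemeOver ℂ⦄, IsSmoothProjective 4 X → HodgeConjectureFor 4 X)
    (hoff : OffDimFour) : ResidualSectorComplement :=
  fun _hT ↦ offDimFour_iff_summit.1 hoff

/-- Any `T`-free strengthening / hypothesis `P` (Family A) concludes the crux only through `P → S` —
a summit thesis (specialisation of the law of lines). -/
theorem tfree_strengthening (P : Prop) (h : P → _root_.HodgeConjecture) :
    P → ResidualSectorComplement :=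
  fun hP ↦ residualSectorComplement_of_summit (h hP)

/-! ## §6 Negation — what a counterexample to the crux is -/

/-- A counterexample to `C` is a PROOF of the route target together with a DISPROOF of the Hodge
conjecture: strictly more than a disproof of HC. -/
theorem counterexample_shape :
    ¬ ResidualSectorComplement ↔ FermatFourfoldsHCModResidual ∧ ∃ (n : ℕ) (X : SchemeOver ℂ),
      IsSmoothProjective n X ∧ ¬ HodgeConjectureFor n X := by
  rw [not_residualSectorComplement_iff]
  refine and_congr_right fun _ ↦ ?_
  constructor
  · intro hnS
    by_contra hall
    apply hnS
    intro n X hX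
    by_contra hX'
    exact hall ⟨n, X, hX, hX'⟩
  · rintro ⟨n, X, hX, hnX⟩ hS
    exact hnX (hS hX)

/-- **Sharpened kill shape**: the non-algebraic Hodge class of a counterexample to `C` may be taken
in dimension `≠ 4` (replace a bad fourfold `X` by the fivefold `X × ℙ¹`, §2) — i.e. entirely OUTSIDE
the route's universe of fourfolds; nothing the route computes about Fermat eigenlines constrains it. -/
theorem counterexample_offDimFour :
    ¬ ResidualSectorComplement ↔ FermatFourfoldsHCModResidual ∧ ∃ (n : ℕ) (X : SchemeOver ℂ),
      n ≠ 4 ∧ IsSmoothProjective n X ∧ ¬ HodgeConjectureFor n X := by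
  rw [not_residualSectorComplement_iff, ← offDimFour_iff_summit]
  refine and_congr_right fun _ ↦ ?_
  constructor
  · intro hn
    by_contra hall
    apply hn
    intro n X hn4 hX
    by_contra hX'
    exact hall ⟨n, X, hn4, hX, hX'⟩
  · rintro ⟨n, X, hn4, hX, hnX⟩ hO
    exact hnX (hO hn4 hX)

/-- Any refutation of the crux refutes the formal summit. -/
theorem not_summit_of_not_residualSectorComplement (h : ¬ ResidualSectorComplement) :
    ¬ _root_.HodgeConjecture :=
  (not_residualSectorComplement_iff.1 h).2

end Summit.HodgeConjecture.HodgeConjecture.Cruxes.ResidualSectorComplement.StrategistCensusR1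

end
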